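import Mathlib
import Summits.NavierStokesRegularity.NavierStokesRegularity.Theorems.EulerZoomLiouvillePowerGaugeEulerLiouvilleDistributionallyPolynomialTools
import Summits.NavierStokesRegularity.NavierStokesRegularity.Theorems.EulerZoomLiouvillePowerGaugeEulerLiouvillePolynomialTimePast
import HarnessLib

/-!
# Crux `EulerZoomLiouville.PowerGaugeEulerLiouville` (stmt-NavierStokesRegularity-19832), stub `stub_nonSelfSimilarRest`:
# `∂ₜ^{N+1} u = 0` IN `𝒟'` ⇒ POLYNOMIAL IN TIME A.E. on a past slab (Lagrange assembly of `N+1` good slices) ⇒ TRIVIAL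

Helper file (theorems only; `--supports stmt-NavierStokesRegularity-19832`; def-free).  Hand leafhand-ns-eulerzoomliouville-10 g4; step 2/2 of the `𝒟'` form of
hand 11 g0's polynomial-in-time stratum: `…DistributionallyPolynomialTools` (step 1/2, the one-variable `N`-th order du Bois-Reymond lemma) turns
`∫∫ θ^{(N+1)}(t)⟪u, Φ⟫ = 0` into polynomial pairings `t ↦ ∫χ⟪u(t), e⟫` of degree `≤ N` on every time window; Lagrange interpolation through `N+1` distinct
good slices (Mathlib `Lagrange.eq_interpolate`) assembles locally integrable fields `U_0, …, U_N` with `u(t,x) = Σ_{k≤N} t^k U_k(x)` a.e. on the slab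
(`DistPoly.exists_ae_eq_poly`), and hand 11 g0's `PolyPast.ae_eq_zero_of_gauge_of_aePolynomialPast` (`…PolynomialTimePast`) kills the member
(`Loc.ae_eq_zero_of_distributionallyPolynomialPast`, binder `Birth.nonSelfSimilar_of_distributionallyPolynomialPast`).  `N = 1`: `…DistributionallyAffine`.

WHAT THIS IS NOT: nothing about Navier–Stokes; not a proof of the stub or of the crux. [folklore; Brezis2011 Lemma 8.1]
-/

noncomputable section

-- flat `Theorems/<Route><Decl>…` files of one crux share the namespace of the crux (tree convention)
set_option linter.dupNamespace false

open MeasureTheory Set Filter Topology Metric Function TopologicalSpace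
open scoped RealInnerProductSpace NNReal ENNReal ContDiff Polynomial

namespace Summit.NavierStokesRegularity.NavierStokesRegularity.Theorems.PowerGaugeEulerLiouville

open Literature.Analysis Literature.Analysis.FunctionSpaces Literature.Analysis.FluidPDE

namespace DistPoly

/-! ## 1. Lagrange interpolation of a real polynomial function of degree `≤ N` through `N+1` distinct nodes -/

/-- `Σ_{k≤N} e_k t^k = Σ_{j≤N} ℓ_j(t) · Σ_{k≤N} e_k τ_j^k`, `ℓ_j` the Lagrange basis polynomials of the distinct nodes `τ_0, …, τ_N`
(Mathlib `Lagrange.eq_interpolate` for the polynomial `Σ e_k X^k` of degree `< N+1`). [folklore] -/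
theorem sum_pow_eq_sum_lagrange (N : ℕ) (e : ℕ → ℝ) {τ : ℕ → ℝ} (hτ : Set.InjOn τ (Finset.range (N + 1) : Finset ℕ)) (t : ℝ) :
    ∑ k ∈ Finset.range (N + 1), e k * t ^ k =
      ∑ j ∈ Finset.range (N + 1), (Lagrange.basis (Finset.range (N + 1)) τ j).eval t * ∑ k ∈ Finset.range (N + 1), e k * τ j ^ k := by
  classical
  set f : ℝ[X] := ∑ i : Fin (N + 1), Polynomial.C (e i) * Polynomial.X ^ (i : ℕ) with hf
  have hfe : ∀ x : ℝ, f.eval x = ∑ k ∈ Finset.range (N + 1), e k * x ^ k := by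
    intro x
    rw [hf, Polynomial.eval_finsetSum, Finset.sum_range (fun k => e k * x ^ k)]
    simp
  have hdeg : f.degree < ((Finset.range (N + 1)).card : WithBot ℕ) := by
    rw [Finset.card_range]
    exact Polynomial.degree_sum_fin_lt (fun i : Fin (N + 1) => e i)
  have hint := Lagrange.eq_interpolate (s := Finset.range (N + 1)) (v := τ) hτ hdeg
  have h : f.eval t = ∑ j ∈ Finset.range (N + 1), f.eval (τ j) * (Lagrange.basis (Finset.range (N + 1)) τ j).eval t := by
    conv_lhs => rw [hint]
    rw [Lagrange.interpolate_apply, Polynomial.eval_finsetSum]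
    refine Finset.sum_congr rfl fun j _ => ?_
    rw [Polynomial.eval_mul, Polynomial.eval_C]
  rw [← hfe t, h]
  refine Finset.sum_congr rfl fun j _ => ?_
  rw [hfe, mul_comm]

/-- The Lagrange basis polynomial of `N+1` distinct nodes, as a function: `ℓ_j(t) = Σ_{k≤N} (coeff_k ℓ_j) t^k`. [folklore] -/
theorem eval_basis_eq_sum (N : ℕ) {τ : ℕ → ℝ} (hτ : Set.InjOn τ (Finset.range (N + 1) : Finset ℕ)) {j : ℕ} (hj : j ∈ Finset.range (N + 1))
    (t : ℝ) :
    (Lagrange.basis (Finset.range (N + 1)) τ j).eval t =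
      ∑ k ∈ Finset.range (N + 1), (Lagrange.basis (Finset.range (N + 1)) τ j).coeff k * t ^ k := by
  refine Polynomial.eval_eq_sum_range' ?_ t
  rw [Lagrange.natDegree_basis hτ hj, Finset.card_range]
  omega

/-! ## 2. Support of iterated derivatives of cutoffs -/

/-- `tsupport (θ^{(n)}) ⊆ tsupport θ`. [folklore] -/
theorem tsupport_iterate_deriv_subset {θ : ℝ → ℝ} : ∀ n : ℕ, tsupport (deriv^[n] θ) ⊆ tsupport θ := by
  intro n
  induction n with
  | zero => simp
  | succ n ih => rw [Function.iterate_succ_apply']; exact tsupport_deriv_subset.trans ih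

/-! ## 3. The slab: pairings are a.e. polynomial on every window -/

variable {u : ℝ → EuclideanSpace ℝ (Fin 3) → EuclideanSpace ℝ (Fin 3)} {T : ℝ}

/-- **On each window the pairing `g(t) = ∫ χ ⟪u(t), e⟫` is a.e. a polynomial of degree `≤ N`** whenever `∫∫ θ^{(N+1)}(t)⟪u(t,x), Φ(x)⟫ = 0` for all
`θ ∈ C_c^∞((−∞,T))` and all continuous compactly supported `Φ`. [folklore; Brezis2011 Lemma 8.1] -/
theorem exists_pairing_ae_poly (N : ℕ)
    (hu : LocallyIntegrableOn (uncurry u) (Iio T ×ˢ (univ : Set (EuclideanSpace ℝ (Fin 3)))) volume)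
    (hpoly : ∀ θ : ℝ → ℝ, ContDiff ℝ ∞ θ → HasCompactSupport θ → tsupport θ ⊆ Iio T →
      ∀ Φ : EuclideanSpace ℝ (Fin 3) → EuclideanSpace ℝ (Fin 3), Continuous Φ → HasCompactSupport Φ →
        ∫ z : ℝ × EuclideanSpace ℝ (Fin 3), deriv^[N + 1] θ z.1 * ⟪u z.1 z.2, Φ z.2⟫ = 0)
    {a b : ℝ} (hbT : b < T) {χ : EuclideanSpace ℝ (Fin 3) → ℝ} (hχ : Continuous χ) (hχc : HasCompactSupport χ)
    (e : EuclideanSpace ℝ (Fin 3)) :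
    ∃ c : ℕ → ℝ, ∀ᵐ t ∂(volume.restrict (Ioo a b)), ∫ x, χ x * ⟪u t x, e⟫ = ∑ k ∈ Finset.range (N + 1), c k * t ^ k := by
  refine exists_poly_of_forall_setIntegral_iterate_deriv_mul_eq_zero (a := a) (b := b) N
    (DistSteady.integrableOn_pairing hu hbT hχ hχc e) (fun θ hθ hθc hθab => ?_)
  have hθT : tsupport θ ⊆ Iio T := hθab.trans fun t ht => ht.2.trans hbT
  have h := DistSteady.setIntegral_deriv_mul_pairing_eq_zero hu hbT.le hχ hχc e (hθ.iterate_deriv N) (hasCompactSupport_iterate_deriv hθc N)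
    ((tsupport_iterate_deriv_subset N).trans hθab)
    (by
      have := hpoly θ hθ hθc hθT _ (hχ.smul continuous_const) (hχc.smul_right (f' := fun _ : EuclideanSpace ℝ (Fin 3) => e))
      rwa [Function.iterate_succ_apply'] at this)
  rwa [← Function.iterate_succ_apply' deriv N θ] at h

/-! ## 4. `∂ₜ^{N+1} u = 0` in `𝒟'` ⇒ a.e. polynomial in time -/

/-- **`∂ₜ^{N+1}u = 0` IN `𝒟'` ⇒ A.E. POLYNOMIAL IN TIME OF DEGREE `≤ N`.**  Let `u` be locally integrable on the slab `(−∞,T) × ℝ³` with locally integrable slices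
`u(t)` for a.e. `t < T`, and suppose `∫∫ θ^{(N+1)}(t) ⟪u(t,x), Φ(x)⟫ = 0` for every `θ ∈ C_c^∞((−∞,T))` and every continuous compactly supported field `Φ`.
Then there are locally integrable `U_0, …, U_N : ℝ³ → ℝ³` with `u(t, x) = Σ_{k≤N} t^k U_k(x)` for a.e. `(t, x) ∈ (−∞,T) × ℝ³`. [folklore; Brezis2011 Lemma 8.1] -/
theorem exists_ae_eq_poly (N : ℕ)
    (hu : LocallyIntegrableOn (uncurry u) (Iio T ×ˢ (univ : Set (EuclideanSpace ℝ (Fin 3)))) volume)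
    (hsl : ∀ᵐ t ∂(volume.restrict (Iio T)), LocallyIntegrable (u t) volume)
    (hpoly : ∀ θ : ℝ → ℝ, ContDiff ℝ ∞ θ → HasCompactSupport θ → tsupport θ ⊆ Iio T →
      ∀ Φ : EuclideanSpace ℝ (Fin 3) → EuclideanSpace ℝ (Fin 3), Continuous Φ → HasCompactSupport Φ →
        ∫ z : ℝ × EuclideanSpace ℝ (Fin 3), deriv^[N + 1] θ z.1 * ⟪u z.1 z.2, Φ z.2⟫ = 0) :
    ∃ U : ℕ → EuclideanSpace ℝ (Fin 3) → EuclideanSpace ℝ (Fin 3), (∀ k, LocallyIntegrable (U k) volume) ∧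
      ∀ᵐ z ∂(volume.restrict (Iio T ×ˢ (univ : Set (EuclideanSpace ℝ (Fin 3))))),
        u z.1 z.2 = ∑ k ∈ Finset.range (N + 1), z.1 ^ k • U k z.2 := by
  classical
  -- adapted from Theorems/EulerZoomLiouvillePowerGaugeEulerLiouvilleDistributionallyAffine.lean (`DistAffine.exists_ae_eq_affine`, hand 10 g4)
  have hfam : ∀ n : ℕ, ∃ D : Set (EuclideanSpace ℝ (Fin 3) → ℝ), D.Countable ∧
      (∀ ψ ∈ D, IsTestFunctionOn (⊤ : Opens (EuclideanSpace ℝ (Fin 3))) ψ ∧ tsupport ψ ⊆ closedBall (0 : EuclideanSpace ℝ (Fin 3)) n) ∧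
      ∀ ψ : EuclideanSpace ℝ (Fin 3) → ℝ, IsTestFunctionOn (⊤ : Opens (EuclideanSpace ℝ (Fin 3))) ψ →
        tsupport ψ ⊆ closedBall (0 : EuclideanSpace ℝ (Fin 3)) n →
          ∃ s : ℕ → EuclideanSpace ℝ (Fin 3) → ℝ, (∀ k, s k ∈ D) ∧ TendstoUniformly s ψ atTop ∧
            TendstoUniformly (fun k => fderiv ℝ (s k)) (fderiv ℝ ψ) atTop := fun n =>
    exists_countable_testFunctions_dense (⊤ : Opens (EuclideanSpace ℝ (Fin 3))) (isCompact_closedBall 0 n)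
  choose D hDc hD hDd using hfam
  set wa : ℕ → ℝ := fun m => T - m - 2 with hwa
  set wb : ℕ → ℝ := fun m => T - 1 / ((m : ℝ) + 1) with hwb
  have hwbT : ∀ m, wb m < T := fun m => by
    simp only [hwb]
    have : (0 : ℝ) < 1 / ((m : ℝ) + 1) := by positivity
    linarith
  have hwin : ∀ t : ℝ, t < T → ∃ M : ℕ, ∀ m : ℕ, M ≤ m → t ∈ Ioo (wa m) (wb m) := by
    intro t htT
    obtain ⟨N₁, hN₁⟩ := exists_nat_gt (T - t)
    obtain ⟨N₂, hN₂⟩ := exists_nat_gt (1 / (T - t))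
    refine ⟨max N₁ N₂, fun m hm => ⟨?_, ?_⟩⟩
    · simp only [hwa]
      have h1 : (N₁ : ℝ) ≤ m := by exact_mod_cast (le_max_left N₁ N₂).trans hm
      linarith
    · simp only [hwb]
      have h1 : (N₂ : ℝ) ≤ m := by exact_mod_cast (le_max_right N₁ N₂).trans hm
      have hδ : 0 < T - t := by linarith
      have h3 : 1 / (T - t) < (m : ℝ) + 1 := by linarith
      have h4 : 1 / ((m : ℝ) + 1) < T - t := by
        rw [div_lt_iff₀ (by positivity)]
        rw [div_lt_iff₀ hδ] at h3
        linarith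
      linarith
  choose! Mw hMw using hwin
  -- polynomial laws of the pairings on each window
  have hconst : ∀ (m n : ℕ) (χ : D n) (i : Fin 3), ∃ c : ℕ → ℝ, ∀ᵐ t ∂(volume.restrict (Ioo (wa m) (wb m))),
      ∫ x, (χ : EuclideanSpace ℝ (Fin 3) → ℝ) x * ⟪u t x, EuclideanSpace.single i (1 : ℝ)⟫ = ∑ k ∈ Finset.range (N + 1), c k * t ^ k :=
    fun m n χ i => exists_pairing_ae_poly N hu hpoly (hwbT m) (hD n χ χ.2).1.contDiff.continuous (hD n χ χ.2).1.hasCompactSupport _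
  choose C hC using hconst
  have hcount : ∀ n, Countable (D n) := fun n => (hDc n).to_subtype
  have hgood : ∀ᵐ t ∂(volume.restrict (Iio T)), LocallyIntegrable (u t) volume ∧
      ∀ (m n : ℕ) (χ : D n) (i : Fin 3), t ∈ Ioo (wa m) (wb m) →
        ∫ x, (χ : EuclideanSpace ℝ (Fin 3) → ℝ) x * ⟪u t x, EuclideanSpace.single i (1 : ℝ)⟫ = ∑ k ∈ Finset.range (N + 1), C m n χ i k * t ^ k := by
    refine hsl.and ?_
    refine ae_all_iff.2 fun m => ae_all_iff.2 fun n => ae_all_iff.2 fun χ => ae_all_iff.2 fun i => ?_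
    exact ae_restrict_of_ae (ae_imp_of_ae_restrict (hC m n χ i))
  -- `N+1` distinct good nodes
  have hpos : (volume : Measure ℝ) (Iio T) ≠ 0 := by
    rw [Real.volume_Iio]; exact ENNReal.top_ne_zero
  have hex : ∀ F : Finset ℝ, ∃ t, (t ∈ Iio T ∧ (LocallyIntegrable (u t) volume ∧
      ∀ (m n : ℕ) (χ : D n) (i : Fin 3), t ∈ Ioo (wa m) (wb m) →
        ∫ x, (χ : EuclideanSpace ℝ (Fin 3) → ℝ) x * ⟪u t x, EuclideanSpace.single i (1 : ℝ)⟫ = ∑ k ∈ Finset.range (N + 1), C m n χ i k * t ^ k)) ∧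
      t ∉ F := by
    intro F
    have hF : ∀ᵐ t ∂(volume.restrict (Iio T)), t ∉ F := by
      have h : (volume.restrict (Iio T)) (F : Set ℝ) = 0 := (F.finite_toSet).measure_zero _
      exact compl_mem_ae_iff.2 h
    obtain ⟨t, htT, hgt, htF⟩ := Measure.exists_mem_of_measure_ne_zero_of_ae hpos (hgood.and hF)
    exact ⟨t, ⟨htT, hgt⟩, htF⟩
  choose pick hpick using hex
  let S : ℕ → Finset ℝ := fun n => Nat.rec ∅ (fun _ acc => insert (pick acc) acc) n
  set τ : ℕ → ℝ := fun n => pick (S n) with hτdef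
  have hS : ∀ n, S (n + 1) = insert (τ n) (S n) := fun n => rfl
  have hmem : ∀ n i, i < n → τ i ∈ S n := by
    intro n
    induction n with
    | zero => intro i hi; exact absurd hi (Nat.not_lt_zero _)
    | succ n ih =>
      intro i hi
      rw [hS]
      rcases Nat.lt_succ_iff_lt_or_eq.1 hi with h | h
      · exact Finset.mem_insert_of_mem (ih i h)
      · rw [h]; exact Finset.mem_insert_self _ _
  have hτinj : Function.Injective τ := by
    intro i j hij
    by_contra hne
    rcases lt_or_gt_of_ne hne with h | h
    · have h1 : τ i ∈ S j := hmem j i h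
      rw [hij] at h1
      exact (hpick (S j)).2 h1
    · have h1 : τ j ∈ S i := hmem i j h
      rw [← hij] at h1
      exact (hpick (S i)).2 h1
  have hτon : Set.InjOn τ (Finset.range (N + 1) : Finset ℕ) := hτinj.injOn
  have hτgood : ∀ j, τ j ∈ Iio T ∧ (LocallyIntegrable (u (τ j)) volume ∧
      ∀ (m n : ℕ) (χ : D n) (i : Fin 3), τ j ∈ Ioo (wa m) (wb m) →
        ∫ x, (χ : EuclideanSpace ℝ (Fin 3) → ℝ) x * ⟪u (τ j) x, EuclideanSpace.single i (1 : ℝ)⟫ =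
          ∑ k ∈ Finset.range (N + 1), C m n χ i k * τ j ^ k) := fun j => (hpick (S j)).1
  -- the coefficient fields
  set s : Finset ℕ := Finset.range (N + 1) with hsdef
  set L : ℕ → ℝ[X] := fun j => Lagrange.basis s τ j with hLdef
  set U : ℕ → EuclideanSpace ℝ (Fin 3) → EuclideanSpace ℝ (Fin 3) := fun k x => ∑ j ∈ s, (L j).coeff k • u (τ j) x with hU
  have hUl : ∀ k, LocallyIntegrable (U k) volume := fun k =>
    locallyIntegrable_finsetSum s fun j _ =>
      ((hτgood j).2.1.smul ((L j).coeff k) : LocallyIntegrable (fun x => (L j).coeff k • u (τ j) x) volume)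
  refine ⟨U, hUl, ?_⟩
  -- the polynomial field at time `t` is the Lagrange interpolation of the node slices
  have hinterp : ∀ t : ℝ, ∀ x, ∑ k ∈ s, t ^ k • U k x = ∑ j ∈ s, (L j).eval t • u (τ j) x := by
    intro t x
    simp only [hU, Finset.smul_sum, smul_smul]
    rw [Finset.sum_comm]
    refine Finset.sum_congr rfl fun j hj => ?_
    rw [← Finset.sum_smul, eval_basis_eq_sum N hτon hj t]
    refine congrArg (fun r : ℝ => r • u (τ j) x) (Finset.sum_congr rfl fun k _ => mul_comm _ _)
  have hslice : ∀ᵐ t ∂(volume.restrict (Iio T)), (fun x => u t x - ∑ k ∈ s, t ^ k • U k x) =ᵐ[volume] 0 := by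
    rw [ae_restrict_iff' measurableSet_Iio] at hgood ⊢
    filter_upwards [hgood] with t hgt htT
    obtain ⟨htl, htC⟩ := hgt htT
    -- a common window for `t` and all nodes
    set m : ℕ := max (Mw t) (s.sup fun j => Mw (τ j)) with hm
    have hmt : t ∈ Ioo (wa m) (wb m) := hMw t htT m (le_max_left _ _)
    have hmτ : ∀ j ∈ s, τ j ∈ Ioo (wa m) (wb m) := fun j hj =>
      hMw (τ j) (hτgood j).1 m ((Finset.le_sup (f := fun j => Mw (τ j)) hj).trans (le_max_right _ _))
    have hVl : LocallyIntegrable (fun x => ∑ k ∈ s, t ^ k • U k x) volume :=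
      locallyIntegrable_finsetSum s fun k _ => ((hUl k).smul (t ^ k) : LocallyIntegrable (fun x => t ^ k • U k x) volume)
    have heq : ∀ n, ∀ χ ∈ D n, ∀ i : Fin 3,
        ∫ x, χ x * ⟪u t x, EuclideanSpace.single i (1 : ℝ)⟫ = ∫ x, χ x * ⟪∑ k ∈ s, t ^ k • U k x, EuclideanSpace.single i (1 : ℝ)⟫ := by
      intro n χ hχ i
      have hχT := (hD n χ hχ).1
      set ei : EuclideanSpace ℝ (Fin 3) := EuclideanSpace.single i (1 : ℝ) with hei
      -- integrability of the node pairings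
      have hK : IsCompact (tsupport χ) := hχT.hasCompactSupport
      have hz : ∀ x ∉ tsupport χ, χ x = 0 := fun x hx => image_eq_zero_of_notMem_tsupport hx
      have hint : ∀ j, Integrable (fun x => χ x * ⟪u (τ j) x, ei⟫) volume := fun j =>
        integrable_mul_of_eq_zero_off_compact hK hχT.contDiff.continuous hz (((hτgood j).2.1.integrableOn_isCompact hK).inner_const ei)
      have e1 : (fun x => χ x * ⟪∑ k ∈ s, t ^ k • U k x, ei⟫) = fun x => ∑ j ∈ s, (L j).eval t * (χ x * ⟪u (τ j) x, ei⟫) := by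
        funext x
        rw [hinterp t x, sum_inner, Finset.mul_sum]
        refine Finset.sum_congr rfl fun j _ => ?_
        rw [inner_smul_left]
        simp only [conj_trivial]
        ring
      rw [e1, integral_finsetSum s fun j _ => (hint j).const_mul _]
      simp_rw [MeasureTheory.integral_const_mul]
      rw [htC m n ⟨χ, hχ⟩ i hmt, sum_pow_eq_sum_lagrange N (C m n ⟨χ, hχ⟩ i) hτon t]
      refine Finset.sum_congr rfl fun j hj => ?_
      rw [(hτgood j).2.2 m n ⟨χ, hχ⟩ i (hmτ j hj)]
    have h := DistSteady.ae_eq_of_pairings_eq htl hVl hD hDd heq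
    filter_upwards [h] with x hx
    simp [hx]
  -- slices to slab
  have hprod : (volume.restrict (Iio T ×ˢ (univ : Set (EuclideanSpace ℝ (Fin 3)))) : Measure (ℝ × EuclideanSpace ℝ (Fin 3))) =
      ((volume : Measure ℝ).restrict (Iio T)).prod (volume : Measure (EuclideanSpace ℝ (Fin 3))) := by
    rw [Measure.volume_eq_prod, ← Measure.restrict_univ (μ := (volume : Measure (EuclideanSpace ℝ (Fin 3)))),
      Measure.prod_restrict, Measure.restrict_univ]
  have hmeas : AEStronglyMeasurable (uncurry fun t x => u t x - ∑ k ∈ s, t ^ k • U k x)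
      (volume.restrict (Iio T ×ˢ (univ : Set (EuclideanSpace ℝ (Fin 3))))) := by
    have h1 : AEStronglyMeasurable (uncurry u) (volume.restrict (Iio T ×ˢ (univ : Set (EuclideanSpace ℝ (Fin 3))))) :=
      hu.aestronglyMeasurable
    have h2 : AEStronglyMeasurable (fun z : ℝ × EuclideanSpace ℝ (Fin 3) => ∑ k ∈ s, z.1 ^ k • U k z.2)
        (volume.restrict (Iio T ×ˢ (univ : Set (EuclideanSpace ℝ (Fin 3))))) := by
      rw [hprod]
      exact Finset.aestronglyMeasurable_fun_sum s fun k _ =>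
        ((continuous_fst.pow k).aestronglyMeasurable).smul (hUl k).aestronglyMeasurable.comp_snd
    exact h1.sub h2
  have h0 := FrameSteady.ae_zero_of_ae_slice hmeas hslice
  filter_upwards [h0] with z hz
  exact sub_eq_zero.1 hz

end DistPoly

/-! ## 5. Member level and binder language -/

/-- **`∂ₜ^{N+1}u = 0` IN `𝒟'` ON A PAST SLAB ⇒ TRIVIAL** (member level, every `ρ > 0`, any `N`, no regularity beyond the class, no ansatz).  Crux hypotheses
verbatim, `T₁ ≤ 0`, and `∫∫ θ^{(N+1)}(t) ⟪u(t,x), Φ(x)⟫ = 0` for every `θ ∈ C_c^∞((−∞,T₁))` and every continuous compactly supported `Φ`.  Then `u = 0`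
a.e. on the slab: `u` is a.e. a polynomial in time on the past slab (`DistPoly.exists_ae_eq_poly`) and hand 11 g0's
`PolyPast.ae_eq_zero_of_gauge_of_aePolynomialPast` applies. [folklore] -/
theorem Loc.ae_eq_zero_of_distributionallyPolynomialPast {ρ : ℝ} (hρ : 0 < ρ)
    {u : ℝ → EuclideanSpace ℝ (Fin 3) → EuclideanSpace ℝ (Fin 3)} {p : ℝ → EuclideanSpace ℝ (Fin 3) → ℝ}
    {H : ℝ → EuclideanSpace ℝ (Fin 3) → EuclideanSpace ℝ (Fin 3) →L[ℝ] EuclideanSpace ℝ (Fin 3)} {c : ℝ≥0}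
    (hsw : IsSuitableWeakSolutionOn (slab (EuclideanSpace ℝ (Fin 3)) (Iio 0) isOpen_Iio) 0 0 u p)
    (hH : HasWeakSpatialGradientOn (slab (EuclideanSpace ℝ (Fin 3)) (Iio 0) isOpen_Iio) u H)
    (hc : ∀ a : ℝ, 0 < a → ENNReal.ofReal (a ^ (2 * ρ)) * cknA a (0 : ℝ × EuclideanSpace ℝ (Fin 3)) u +
        ENNReal.ofReal (a ^ ρ) * cknE a (0 : ℝ × EuclideanSpace ℝ (Fin 3)) H +
        ENNReal.ofReal (a ^ (2 * ρ)) * cknD a (0 : ℝ × EuclideanSpace ℝ (Fin 3)) p ≤ (c : ℝ≥0∞))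
    {T₁ : ℝ} (hT₁ : T₁ ≤ 0) (N : ℕ)
    (hpoly : ∀ θ : ℝ → ℝ, ContDiff ℝ ∞ θ → HasCompactSupport θ → tsupport θ ⊆ Iio T₁ →
      ∀ Φ : EuclideanSpace ℝ (Fin 3) → EuclideanSpace ℝ (Fin 3), Continuous Φ → HasCompactSupport Φ →
        ∫ z : ℝ × EuclideanSpace ℝ (Fin 3), deriv^[N + 1] θ z.1 * ⟪u z.1 z.2, Φ z.2⟫ = 0) :
    uncurry u =ᵐ[volume.restrict (Iio (0 : ℝ) ×ˢ (univ : Set (EuclideanSpace ℝ (Fin 3))))] 0 := by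
  have hu : LocallyIntegrableOn (uncurry u) (Iio T₁ ×ˢ (univ : Set (EuclideanSpace ℝ (Fin 3)))) volume := by
    have h0 : LocallyIntegrableOn (uncurry u) (Iio (0 : ℝ) ×ˢ (univ : Set (EuclideanSpace ℝ (Fin 3)))) volume := by
      simpa only [coe_slab] using hsw.distributional.1
    exact h0.mono_set (prod_mono (Iio_subset_Iio hT₁) Subset.rfl)
  have hsl : ∀ᵐ t ∂(volume.restrict (Iio T₁)), LocallyIntegrable (u t) volume := by
    filter_upwards [FrameSteady.ae_hasWeakFDerivOn_slice_past hH hT₁] with t ht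
    exact locallyIntegrableOn_univ.1 (by simpa only [Opens.coe_top] using ht.locallyIntegrableOn)
  obtain ⟨U, -, hU⟩ := DistPoly.exists_ae_eq_poly N hu hsl hpoly
  exact PolyPast.ae_eq_zero_of_gauge_of_aePolynomialPast hρ hsw hH hc hT₁ N hU

/-- **Binder language: NO MEMBER HAS `∂ₜ^{N+1}u = 0` IN `𝒟'` ON A PAST SLAB** (every `ρ > 0`, any `N`): a class member with
`∫∫ θ^{(N+1)}(t)⟪u(t,x), Φ(x)⟫ = 0` for all `θ ∈ C_c^∞((−∞,T₁))`, all continuous compactly supported `Φ`, some `T₁ ≤ 0`, some `N`, is trivial — the common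
roof of `Birth.nonSelfSimilar_of_distributionallySteadyPast` (`N = 0`, hand 10 g3), `…_of_distributionallyAffinePast` (`N = 1`, hand 10 g4) and the a.e. form
`Birth.nonSelfSimilar_of_aePolynomialTimePast` (hand 11 g0). [folklore] -/
theorem Birth.nonSelfSimilar_of_distributionallyPolynomialPast :
    ∀ ρ : ℝ, 0 < ρ →
      ∀ (u : ℝ → EuclideanSpace ℝ (Fin 3) → EuclideanSpace ℝ (Fin 3)) (p : ℝ → EuclideanSpace ℝ (Fin 3) → ℝ)
        (H : ℝ → EuclideanSpace ℝ (Fin 3) → EuclideanSpace ℝ (Fin 3) →L[ℝ] EuclideanSpace ℝ (Fin 3)) (c : ℝ≥0),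
        Birth.InClass ρ u p H c →
          (∃ T₁ : ℝ, T₁ ≤ 0 ∧ ∃ N : ℕ, ∀ θ : ℝ → ℝ, ContDiff ℝ ∞ θ → HasCompactSupport θ → tsupport θ ⊆ Iio T₁ →
              ∀ Φ : EuclideanSpace ℝ (Fin 3) → EuclideanSpace ℝ (Fin 3), Continuous Φ → HasCompactSupport Φ →
                ∫ z : ℝ × EuclideanSpace ℝ (Fin 3), deriv^[N + 1] θ z.1 * ⟪u z.1 z.2, Φ z.2⟫ = 0) →
          uncurry u =ᵐ[volume.restrict (Iio (0 : ℝ) ×ˢ (univ : Set (EuclideanSpace ℝ (Fin 3))))] 0 := by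
  intro ρ hρ u p H c hcl h
  obtain ⟨T₁, hT₁, N, hpoly⟩ := h
  exact Loc.ae_eq_zero_of_distributionallyPolynomialPast hρ hcl.1 hcl.2.1 hcl.2.2 hT₁ N hpoly

end Summit.NavierStokesRegularity.NavierStokesRegularity.Theorems.PowerGaugeEulerLiouville

end
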